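import Literature.IUT.LogVolume.GenuineLogTheta
import Literature.IUT.LogVolume.ArchimedeanPacketHull
import HarnessLib

/-!
# The archimedean summand of `−|log(Θ)|` IS the genuine hull log-volume (route D3, part g)

Proof-only companion of `GenuineLogTheta.lean` (abc-iut-S2). [IUTchIV] Thm. 1.10, proof, Step (vii) (kurims
Apr-2020 manuscript p. 30, read on the page): "`π^{j+1}·B_I` serves as a container for the “union of possible images
of a Θ-pilot object” … an upper bound `(j+1)·log(π)` … The resulting “procession-normalized upper bound” is given
by `((l+5)/4)·log(π)`" "— cf. (E1)".

`ThetaVolumeInput.archLogTheta l := ((l+5)/4)·log π` is the archimedean summand of the DEFINED `−|log(Θ)|` in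
CLOSED FORM. This file identifies it with the GENUINE quantity of abc-iut-L5-t7's `ArchimedeanPacketLogVolume/Hull`:
* `archLogTheta_eq_procAvg` — `((l+5)/4)·log π = (1/ℓ⋇)·Σ_{j=1}^{ℓ⋇} (j+1)·log π` for `l = 2ℓ⋇+1` (abc-iut-S3's
  `Thm110Local.procAvg_arch`, (E1));
* `archLogTheta_eq_procAvg_nlogVol_holomorphicHull` — hence `archLogTheta l` EQUALS the procession-normalised
  Haar log-volume (`ArchPacket.nlogVol`, normalised so that `B_I` has log-volume `0`) of the HOLOMORPHIC HULL of the
  union of possible images `U_j ⊆ M_I = ⊗_{i≤j} ℂ_{v_i}` at a complex place, for ANY regions `U_j` lying in the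
  container `π^{j+1}·B_I` and containing the tensor `⊗(π)` of maximal log-shell elements — which the union of
  possible images does (L5-t7's `procAvg_nlogVol_holomorphicHull_eq`, `holomorphicHull_image_eq`). The weighted
  average over `𝕍(F_mod)^arc` (weights summing to `1`) of this place-independent value is the value itself.

[cite: Mochizuki2012, IUTchIV Thm. 1.10 Step (vii) p. 30] Classical measure theory; nothing disputed is used or
asserted; no side taken on [IUTchIII] Cor. 3.12.
-/

noncomputable section

namespace Literature.IUT.LogVolume

namespace ThetaVolumeInput

open Literature.IUT.LogVolume.Prop15iii ArchPacket
open scoped Pointwise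

/-- **`((l+5)/4)·log π = (1/ℓ⋇)·Σ_{j=1}^{ℓ⋇} (j+1)·log π`** for the prime `l = 2ℓ⋇+1` of pilot data ((E1), p. 30;
abc-iut-S3's `procAvg_arch`). [cite: Mochizuki2012, IUTchIV Thm. 1.10 Step (vii) p. 30] -/
theorem archLogTheta_eq_procAvg {F₀ : Type} [Field F₀] [NumberField F₀] (X : PilotData F₀) :
    archLogTheta X.l = Thm110Local.procAvg X.lstar (fun j => ((j : ℝ) + 1) * Real.log Real.pi) := by
  have hl : 1 ≤ X.lstar := le_trans (by norm_num) X.two_le_lstar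
  rw [Thm110Local.procAvg_arch hl, archLogTheta, X.l_cast]

/-- **The archimedean summand of `−|log(Θ)|` IS the genuine hull log-volume**: for every procession of complex
packets `M_{I_j} = ⊗_{i ∈ I_j} ℂ` (`|I_j| = j+1`) with direct sum decompositions `Φ_j` and regions `U_j` in the
container `π^{j+1}·B_{I_j}` containing the tensor of the maximal log-shell elements `⊗(π)` (as the union of
possible images of the Θ-pilot at `v ∈ 𝕍^arc` does, p. 30), the procession-normalised `nlogVol` of the holomorphic
hulls equals `archLogTheta l` (L5-t7's `procAvg_nlogVol_holomorphicHull_eq` + (E1)).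
[cite: Mochizuki2012, IUTchIV Thm. 1.10 Step (vii) p. 30] -/
theorem archLogTheta_eq_procAvg_nlogVol_holomorphicHull {F₀ : Type} [Field F₀] [NumberField F₀] (X : PilotData F₀)
    {V : Type} [Fintype V] [DecidableEq V] (Ix Jx : ℕ → Type)
    [∀ j, Fintype (Ix j)] [∀ j, DecidableEq (Ix j)] [∀ j, Fintype (Jx j)] [∀ j, Nonempty (Jx j)]
    (Φ : ∀ j, Decomposition (Ix j) V (Jx j)) (U : ∀ j, Set (MI (Ix j) V))
    (hcard : ∀ j, 1 ≤ j → j ≤ X.lstar → Fintype.card (Ix j) = j + 1)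
    (hU : ∀ j, 1 ≤ j → j ≤ X.lstar → U j ⊆ Real.pi ^ (j + 1) • ball (Φ j))
    (hmem : ∀ j, 1 ≤ j → j ≤ X.lstar →
      (PiTensorProduct.tprod ℝ fun (_ : Ix j) (_ : V) => (Real.pi : ℂ)) ∈ U j) :
    archLogTheta X.l =
      Thm110Local.procAvg X.lstar (fun j => nlogVol (Jx j)
        (holomorphicHull (fun _ : Jx j => ℂ) ((Φ j : MI (Ix j) V → (Jx j → ℂ)) '' U j))) := by
  rw [procAvg_nlogVol_holomorphicHull_eq Ix Jx Φ U hcard hU hmem, archLogTheta_eq_procAvg]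

end ThetaVolumeInput

end Literature.IUT.LogVolume

end
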